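import Summits.QuantumFields.YangMills.Theorems.BalabanUVNodesN09NestingOfHierAxial
import Summits.QuantumFields.YangMills.Theorems.BalabanUVNodesN09BackgroundRadiiReg8OfThm1Objects

/-!
# NODE N09 [B12] — THE HIERARCHICAL [B11] BINDERS OF N09's DOORS ARE CONSEQUENCES OF THE LEVEL-WISE ONES: `huniq` ⇐ `h11` + [B7] (53) nesting; `hres` ([I] (1.1)'s
# restriction property) ⇐ level-wise SOLVABILITY at the hierarchical data + a hierarchical (8)-membership — ORDER THEORY of nested constrained minimisation, UNIQUENESS-FREE —
# and both hierarchical slots ⇐ N07's Theorem-1 slot AT OBJECTS + NODE 00's ₈a rows + `hreg8` + the two-radii numerics `2B₃·εreg ≤ εbg ≤ a₀`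

Cell `pub-ymgap` (YM-PLAN Track A, node N09 of 28 = [Balaban1987RG1] Sects. 2–5, `Dag.B12_main`), width seat `pub-ymgap-dag-n09-w1` (generation 7; D-0149 width seat 1∕4,
harness re-seat); helper of K1⁹ `StabilityBRunRowsAtRecordR13SepCoPHV` = stmt-QuantumFields-27364 (`--supports`, `--as helper`, count-neutral).  [I] = [Balaban1987RG1] (CMP 109),
[B7] = [Balaban1985Averaging] (CMP 98), [B11] = [Balaban1985Variational] (CMP 102).  Imports this seat's g2 FILE 5 `…N09NestingOfHierAxial` (p598505; it carries g2 FILES 1–2∕4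
and dag-n21-c's `…N21AveragedDatumRegularity`) and g2 FILE 3 `…N09BackgroundRadiiReg8OfThm1Objects` (p596420; it carries dag-n21-c's `…N21RegularityTransferJunction`).  The door corollary
(dag-n09-w2's v1.2 on-domains door with `hres`∕`huniq` discharged) is the sequel file `…N09OnDomainsDoorOfLevelwiseThm1`.  THEOREMS ONLY (0 `def`, 0 `instance`, 0 `notation`, 0 `sorry`).

WHY.  Every N09 door of record — dag-n09-w2's on-domains doors (v1.0∕v1.1∕v1.2), dag-n09-w3's covariant ∕ two-radii doors, this seat's g2 §4 door, the ₁₀∕₁₁∕₁₃ knits and hence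
dag-n24-c's `h09T` children — displays [B11] Theorem 1 THREE times: `h11 : ∀ k ≤ K, ∀ V ∈ domAlt_k, UkExists k εbg V ∧ UniqueUkOrbit k εbg V` (LEVEL-WISE existence and uniqueness of
the minimal orbit of (0.21)); `hres : ∀ k ≤ K, HRestrict εbg K k (domAlt_k)` ([I] (1.1) p. 260's RESTRICTION PROPERTY: for `V ∈ domAlt_k`, `j < k`, `U_k(V)` is ALSO a minimiser of the
level-`(j+1)` problem at its own datum `Ū^{j+1}(U_k(V))` within `bgReg_{j+1}(εbg)` — `Node00.BackgroundActionT.HRestrict`); `huniq : ∀ k ≤ K, ∀ V ∈ domAlt_k, ∀ j < k, UniqueUkOrbit (j+1)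
εbg (Ū^{j+1}(U_k(V)))` (uniqueness ALONG THE HIERARCHY).  This file shows that the two HIERARCHICAL clauses are not independent inputs:
* §3 `huniq_of_h11`: `huniq` ⇐ `h11` + the [B7] (53) nesting that the doors' own numerics (`hε3 hε2 hε₀` at `εbg`) already buy (this seat's g2 `iterUk_mem_domAlt_of_ukExists`:
  `Ū^{j+1}(U_k V) ∈ domAlt_{j+1}`; at `j+1 = k` the datum is `V` itself, `Node00.iter_Uk`).  ONE BINDER GONE AT NO NEW HYPOTHESIS.
* §1–§2: `hres` is ORDER THEORY.  §1 `isBackground_restrict_of_minimiser_mem` (GENERIC — any `Params`, group, averaging): if `U₀` minimises the Wilson action over `reg₁ ∩ {Ū^{i+n} = V}` and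
  `U₁` minimises it over `reg₂ ∩ {Ū^{i} = Ū^{i}U₀}` with `reg₁ ⊆ reg₂`, `U₁ ∈ reg₁`, then `U₀` minimises over `reg₂ ∩ {Ū^{i} = Ū^{i}U₀}` too and the minimal values agree (`U₀` competes in
  `U₁`'s problem; `U₁` competes in `U₀`'s since `Ū^{i+n}U₁ = Ū^{i+n}U₀ = V`).  NO UNIQUENESS used.  §2 `hres_of_hsolH_of_hreg8H`: at NODE 00's objects (`bgReg_k(εbg) ⊆ bgReg_{j+1}(εbg)`, g2
  `bgReg_anti_level`) `hres` ⇐ level-wise SOLVABILITY at the hierarchical data `hsolH : UkExists (j+1) εbg (Ū^{j+1}(U_k V))` + the HIERARCHICAL (8)-MEMBERSHIP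
  `hreg8H : U_{j+1}(Ū^{j+1}(U_k V)) ∈ bgReg_k(εbg)` («the level-`(j+1)` minimiser at the averaged datum is as regular as a level-`k` background»).
* §4: both hierarchical slots ⇐ N07's THEOREM-1 SLOT AT OBJECTS `hT1` + NODE 00's ₈a rows `hUk` (dag-n21-c p454585 currency — VERBATIM the hypotheses of g2 FILE 3
  `hreg8_of_thm1Objects_of_ukRows`) + the displayed `hreg8` (`U_k^{(εbg)}(V) ∈ bgReg_k(εreg)`) + numerics `0 < εreg`, (53)'s `C₀(d)εreg ≤ ⅓`, `2εreg ≤ c′₂`, `2εreg ≤ a₁`, `0 ≤ B₃` and the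
  TWO-RADII letter **`2B₃·εreg ≤ εbg ≤ a₀`**: by (53) the datum `Ū^{j+1}(U_k V)` is `2εreg(L^{j+1}η_k)²`-regular (dag-n21-c `plaqSmall_iter_avOfRecord_level`), so ₈a's row makes the
  level-`(j+1)` problem solvable there and (8) at level `j+1` (dag-n21-c `plaqSmall_Uk_of_thm1_objects`) puts its minimiser of record in `PlaqSmall(2B₃εreg·η_k²) ⊆ bgReg_k(εbg)`.
  ★ `hres_of_thm1Objects_of_ukRows_of_reg8` = §2 ∘ §4; `hres_huniq_hreg8_of_thm1Objects_of_ukRows_of_h11` (with g2 FILE 3) packages ALL THREE radius∕hierarchy clauses from {`h11`, `hT1`, `hUk`,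
  numerics}.
* §5 A6: the numerics letters are jointly satisfiable inside print's window with `εbg = a₀` (`twoRadii_numerics_inhabited`); the object slots are dag-n21-c's theorems at the zero member
  (`hierarchyBinders_levelZero`); this seat's g3 flat sector (`…N09FlatSectorUniqueness.thm1Clauses_flatSector`) inhabits the conclusions `hres`∕`huniq` at every level.  The DOOR corollary
  (dag-n09-w2's v1.2 on-domains door with `hres` AND `huniq` DISCHARGED, so that N24's `h09T` child reads [B11] as {level-wise `h11`, N07's object slots}) is the sequel file.

LOCATED READING (for def-B ∕ K0-numerics ∕ dag-n24-c; not this seat's to re-point).  (i) Print derives (1.1)'s restriction property from [B11] Thm 1's uniqueness of the regular CRITICAL orbit: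
`U_k(V)` restricted is a critical point of the level-`(j+1)` problem.  The tree's `UniqueUkOrbit` is the MINIMISER reading (D-n07a-1 «critical ↦ minimal»), under which that road is not
available; §1's order-theoretic road replaces it and needs (8) at TWO radii instead — `2B₃·εreg ≤ εbg` — the regime the doors' loop guards already ask for (`εreg < α₀ ≤ 1∕(432L²)`, g6) with
g2's one-token re-key `εbg := a₀`.  At a single radius `εreg = εbg` §4 does NOT fire (the level-`(j+1)` minimiser is only `2B₃εbg·η_k²`-regular); §2 still reduces `hres` to the displayed
`hreg8H`.  (ii) At the V18∕V19 witness `θ₁₃ᶜᶜᴹᵂ` (`εbg = 1 > a₀`, g2 FILE 3 `not_εbg_le_a₀_theta13OfThm1CCMW`) §4's `εbg ≤ a₀` fails like every print-regime letter there; §2–§3 are witness-free.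

HONEST FRAMING — what this is NOT.  Count-neutral kernel ORDER THEORY ∕ bookkeeping at NODE 00's definitions of record BY NAME; [B11] Theorem 1 enters ONLY as the displayed level-wise `h11`
and N07's object slots `hT1`∕`hUk` (levels `k ≥ 1` = Bałaban's theorem, proved nowhere in the tree) — NOTHING of Bałaban's asserted; NO carrier of record re-pointed; `hreg` ∕ N09 NOT discharged;
conjunct 1 (Lemma 4) ∕ FLAG №7 untouched; K0⁷ ∕ K1⁹ ∕ K3⁸ NOT closed; counts unmoved (typed 28∕28 · discharged 5∕28); no summit statement is proved by this seat; one finite four-torus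
programme at fixed `ε = L^{−K}` per run — R4 closes the conditional rung `BalabanLadder.UV` only; NOT continuum ∕ ℝ⁴ ∕ infinite volume ∕ OS; the Yang–Mills mass gap (Clay) is NOT proved by
any of this.
-/

noncomputable section

namespace Summit.QuantumFields.YangMills.BalabanUVNodes.N09HierarchyBindersOfLevelwiseThm1

open MeasureTheory
open Literature.MathematicalPhysics.QuantumFieldTheory.Balaban1983to89
open Literature.MathematicalPhysics.QuantumFieldTheory.Balaban1983to89.T4Continuum (T4Family)
open Literature.MathematicalPhysics.QuantumFieldTheory.Balaban1983to89.Node00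
open Literature.MathematicalPhysics.QuantumFieldTheory.Balaban1983to89.ExpMeanLog (deltaSU)
open Literature.MathematicalPhysics.QuantumFieldTheory.Balaban1983to89.B12GaugeOrbits021 (OrbitRel)
open Summit.QuantumFields.YangMills.BalabanUVNodes.N09BackgroundRadiiTransfer (bgReg_mono)
open Summit.QuantumFields.YangMills.BalabanUVNodes.N09BackgroundRadiiTransferRestrict (bgReg_anti_level)
open Summit.QuantumFields.YangMills.BalabanUVNodes.N09NestingOfHierAxial (iterUk_mem_domAlt_of_ukExists pow_mul_eta_le_inv)
open Summit.QuantumFields.YangMills.BalabanUVNodes.N09BackgroundRadiiReg8OfThm1Objects (hreg8_of_thm1Objects_of_ukRows ukExists_εbg_of_ukRows)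
open Summit.QuantumFields.YangMills.Theorems.N21AveragedDatumRegularity (plaqSmall_iter_avOfRecord_level smallness_inhabited)
open Summit.QuantumFields.YangMills.Theorems.N21RegularityTransferJunction (plaqSmall_Uk_of_thm1_objects thm1_objects_levelZero' ukRows_levelZero)

/-! ## §1  Order theory of nested constrained minimisation (generic: any `Params`, any gauge group, any averaging) -/

section Generic

variable {P : Params} {G : Type*} [GaugeGroup G]

/-- Two fine fields with the same `i`-fold average have the same `(i+n)`-fold average (the averaging of level `i+n` factors through level `i`).
[cite: Balaban1985Averaging, (11)–(12) p.19 (bookkeeping)] -/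
theorem iter_add_eq_of_iter_eq (av : ∀ j, Averaging P j G) {i : ℕ} {U U' : GaugeField P 0 G}
    (h : Averaging.iter av i U = Averaging.iter av i U') : ∀ n : ℕ, Averaging.iter av (i + n) U = Averaging.iter av (i + n) U'
  | 0 => h
  | n + 1 => by
    show (av (i + n)).avg (Averaging.iter av (i + n) U) = (av (i + n)).avg (Averaging.iter av (i + n) U')
    rw [iter_add_eq_of_iter_eq av h n]

/-- ★★★ **RESTRICTION OF A CONSTRAINED MINIMISER ALONG THE HIERARCHY — ORDER THEORY, UNIQUENESS-FREE.**  Let `U₀` minimise the Wilson action over `reg₁ ∩ {Ū^{i+n} = V}` and let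
`U₁` minimise it over `reg₂ ∩ {Ū^{i} = Ū^{i}U₀}` (the level-`i` problem at `U₀`'s own averaged datum), with `reg₁ ⊆ reg₂` and `U₁ ∈ reg₁`.  Then `U₀` ALSO minimises over
`reg₂ ∩ {Ū^{i} = Ū^{i}U₀}`: `U₀` is a competitor of `U₁`'s problem (`A U₁ ≤ A U₀`), and `U₁` is a competitor of `U₀`'s problem because `Ū^{i+n}U₁ = Ū^{i+n}U₀ = V` (`A U₀ ≤ A U₁`).  This is
[I] (1.1) p. 260's restriction property read for MINIMISERS, with the (8)-type membership `U₁ ∈ reg₁` in place of print's uniqueness of critical orbits.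
[cite: Balaban1987RG1, (1.1) p.260 and (0.21) p.256; Balaban1985Variational, Thm 1 (8) p.279] -/
theorem isBackground_restrict_of_minimiser_mem {av : ∀ j, Averaging P j G} {reg₁ reg₂ : Set (GaugeField P 0 G)} {i n : ℕ}
    {V : GaugeField P (i + n) G} {U₀ U₁ : GaugeField P 0 G}
    (h₀ : IsBackground av reg₁ (i + n) V U₀) (h₁ : IsBackground av reg₂ i (Averaging.iter av i U₀) U₁)
    (hsub : reg₁ ⊆ reg₂) (hmem : U₁ ∈ reg₁) :
    IsBackground av reg₂ i (Averaging.iter av i U₀) U₀ := by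
  have hiter : Averaging.iter av (i + n) U₁ = V := by
    rw [iter_add_eq_of_iter_eq av h₁.1 n]
    exact h₀.1
  have hle₀ : wilsonAction4 U₀ ≤ wilsonAction4 U₁ := h₀.2.2 U₁ hmem hiter
  exact ⟨rfl, hsub h₀.2.1, fun U hU hUV => hle₀.trans (h₁.2.2 U hU hUV)⟩

/-- … and the two minimal values agree. [cite: Balaban1987RG1, (0.21)–(0.22) p.256 (bookkeeping)] -/
theorem wilsonAction4_eq_of_restrict {av : ∀ j, Averaging P j G} {reg₁ reg₂ : Set (GaugeField P 0 G)} {i n : ℕ}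
    {V : GaugeField P (i + n) G} {U₀ U₁ : GaugeField P 0 G}
    (h₀ : IsBackground av reg₁ (i + n) V U₀) (h₁ : IsBackground av reg₂ i (Averaging.iter av i U₀) U₁)
    (hsub : reg₁ ⊆ reg₂) (hmem : U₁ ∈ reg₁) :
    wilsonAction4 U₀ = wilsonAction4 U₁ := by
  have hiter : Averaging.iter av (i + n) U₁ = V := by
    rw [iter_add_eq_of_iter_eq av h₁.1 n]
    exact h₀.1
  exact le_antisymm (h₀.2.2 U₁ hmem hiter) (h₁.2.2 U₀ (hsub h₀.2.1) rfl)

end Generic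

variable {F : T4Family} {N : ℕ} [NeZero N]

/-! ## §2  `hres` at NODE 00's objects from level-wise solvability at the hierarchical data + the hierarchical (8)-membership -/

/-- ★★ **THE (1.1) RESTRICTION CLAUSE AT ONE DATUM, ORDER-THEORETICALLY.**  At the `K`-th torus, radius `εbg ≥ 0`, level `k = j + 1 + n`: if the level-`k` problem (0.21) is solvable at
`V`, the level-`(j+1)` problem is solvable at the averaged datum `W := Ū^{j+1}(U_k(V))`, and the level-`(j+1)` minimiser of record there is `εbg·η_k²`-regular (`∈ bgReg_k(εbg)`), then `U_k(V)`
itself minimises the level-`(j+1)` problem at `W` within `bgReg_{j+1}(εbg)` — the `(V, j)` clause of `HRestrict`.  §1 at `reg₁ = bgReg_k(εbg) ⊆ reg₂ = bgReg_{j+1}(εbg)` (this seat's g2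
`bgReg_anti_level`).  NO uniqueness used. [cite: Balaban1987RG1, (1.1)–(1.2) p.260; Balaban1985Variational, Thm 1 (8) p.279] -/
theorem isBackground_restrict_Uk_of_ukExists_of_mem {K j n : ℕ} {εbg : ℝ} (hε : 0 ≤ εbg) {V : GaugeField (F.P K) (j + 1 + n) (SU N)}
    (hsol : UkExists F N K (j + 1 + n) εbg V)
    (hsolH : UkExists F N K (j + 1) εbg (Averaging.iter (avOfRecord F N K) (j + 1) (Uk F N K (j + 1 + n) εbg V)))
    (hreg8H : Uk F N K (j + 1) εbg (Averaging.iter (avOfRecord F N K) (j + 1) (Uk F N K (j + 1 + n) εbg V)) ∈ bgReg F N K (j + 1 + n) εbg) :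
    IsBackground (avOfRecord F N K) (bgReg F N K (j + 1) εbg) (j + 1)
      (Averaging.iter (avOfRecord F N K) (j + 1) (Uk F N K (j + 1 + n) εbg V)) (Uk F N K (j + 1 + n) εbg V) :=
  isBackground_restrict_of_minimiser_mem (isBackground_Uk hsol) (isBackground_Uk hsolH) (bgReg_anti_level (by omega) hε) hreg8H

/-- ★★★ **`hres` FROM LEVEL-WISE SOLVABILITY AT THE HIERARCHICAL DATA + THE HIERARCHICAL (8)-MEMBERSHIP**, for any family of domains `dom k` (the doors read `dom k := domAltOfRecord ν K k`):
`HRestrict εbg K k (dom k)` for every `k ≤ K` from `hsol` (solvability on the domains), `hsolH` (solvability at the averaged data `Ū^{j+1}(U_k V)`, `j < k`) and `hreg8H`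
(`U_{j+1}(Ū^{j+1}(U_k V)) ∈ bgReg_k(εbg)`).  UNIQUENESS-FREE.  CONDITIONAL on the displayed slots; nothing of Bałaban's asserted.
[cite: Balaban1987RG1, (1.1)–(1.2) p.260; Balaban1985Variational, Thm 1 (8) p.279] -/
theorem hres_of_hsolH_of_hreg8H {εbg : ℝ} (hε : 0 ≤ εbg) (K : ℕ) (dom : (k : ℕ) → Set (GaugeField (F.P K) k (SU N)))
    (hsol : ∀ k, k ≤ K → ∀ V ∈ dom k, UkExists F N K k εbg V)
    (hsolH : ∀ k, k ≤ K → ∀ V ∈ dom k, ∀ j < k, UkExists F N K (j + 1) εbg (Averaging.iter (avOfRecord F N K) (j + 1) (Uk F N K k εbg V)))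
    (hreg8H : ∀ k, k ≤ K → ∀ V ∈ dom k, ∀ j < k,
      Uk F N K (j + 1) εbg (Averaging.iter (avOfRecord F N K) (j + 1) (Uk F N K k εbg V)) ∈ bgReg F N K k εbg) :
    ∀ k, k ≤ K → HRestrict F N εbg K k (dom k) := by
  intro k hk V hV j hj
  obtain ⟨n, rfl⟩ : ∃ n, k = j + 1 + n := ⟨k - (j + 1), by omega⟩
  exact isBackground_restrict_Uk_of_ukExists_of_mem hε (hsol _ hk V hV) (hsolH _ hk V hV j hj) (hreg8H _ hk V hV j hj)

/-! ## §3  `huniq` (and `hsolH`) from the level-wise `h11` by [B7] (53) nesting -/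

/-- `L^{j+1}·η_k ≤ 1` for `j < k` (`η_k = L^{−k}`, `L ≥ 2`). [cite: Balaban1987RG1, (1.1) p.260 (bookkeeping)] -/
theorem pow_succ_mul_eta_le_one {K j k : ℕ} (hj : j < k) : ((F.P K).L : ℝ) ^ (j + 1) * (F.P K).eta k ≤ 1 := by
  have hL : (1 : ℝ) ≤ (F.P K).L := by exact_mod_cast (F.P K).hL.2.le
  have hL0 : (0 : ℝ) < (F.P K).L := zero_lt_one.trans_le hL
  have h := pow_mul_eta_le_inv (F := F) (K := K) hj
  calc ((F.P K).L : ℝ) ^ (j + 1) * (F.P K).eta k = (F.P K).L * (((F.P K).L : ℝ) ^ j * (F.P K).eta k) := by ring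
    _ ≤ (F.P K).L * ((F.P K).L : ℝ)⁻¹ := by gcongr
    _ = 1 := mul_inv_cancel₀ hL0.ne'

/-- **THE AVERAGED DATA OF THE MINIMISER STAY IN THE SMALL-FIELD DOMAINS, level `j+1 ≤ k`**: for `V ∈ domAlt_k` solvable at radius `εbg`, `Ū^{j+1}(U_k V) ∈ domAlt_{j+1}` for every `j < k`
(this seat's g2 `iterUk_mem_domAlt_of_ukExists` = [B7] (53) at NODE 00's averaging for `j + 1 < k`; `Node00.iter_Uk` at the top level `j + 1 = k`, where the datum is `V`).
Numerics: `0 < εbg`, `C₀(d)εbg ≤ ⅓`, `2εbg ≤ c′₂`, `2εbg ≤ ν.ε₀·L²`. [cite: Balaban1985Averaging, Prop. 2 (53) p.26; Balaban1987RG1, (0.21) p.256] -/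
theorem iterUk_succ_mem_domAlt_of_ukExists (ν : Stage7Numerics) {εbg : ℝ} {K : ℕ} (hε : 0 < εbg)
    (hε3 : (143 * (((((F.P K).d + 4 : ℕ) : ℝ)) ^ 2 / 4) ^ 2) * εbg ≤ 1 / 3)
    (hε2 : 2 * εbg ≤ 2 * deltaSU (Fin N) / ((((F.P K).d + 4) * (F.P K).L : ℕ) : ℝ) ^ 2) (hε₀ : 2 * εbg ≤ ν.ε₀ * ((F.P K).L : ℝ) ^ 2)
    {k : ℕ} {V : GaugeField (F.P K) k (SU N)} (hV : V ∈ domAltOfRecord F N ν K k) (hex : UkExists F N K k εbg V) {j : ℕ} (hj : j < k) :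
    Averaging.iter (avOfRecord F N K) (j + 1) (Uk F N K k εbg V) ∈ domAltOfRecord F N ν K (j + 1) := by
  rcases (Nat.succ_le_of_lt hj).eq_or_lt with h | h
  · subst h
    rw [iter_Uk hex]
    exact hV
  · exact iterUk_mem_domAlt_of_ukExists ν hε hε3 hε2 hε₀ hex h

/-- ★★ **`hsolH` FROM THE LEVEL-WISE SOLVABILITY `hsol`** on the small-field domains (the averaged data stay in the domains, where `hsol` applies).
[cite: Balaban1985Averaging, Prop. 2 (53) p.26; Balaban1985Variational, Thm 1 p.279] -/
theorem hsolH_of_hsol (ν : Stage7Numerics) {εbg : ℝ} {K : ℕ} (hε : 0 < εbg)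
    (hε3 : (143 * (((((F.P K).d + 4 : ℕ) : ℝ)) ^ 2 / 4) ^ 2) * εbg ≤ 1 / 3)
    (hε2 : 2 * εbg ≤ 2 * deltaSU (Fin N) / ((((F.P K).d + 4) * (F.P K).L : ℕ) : ℝ) ^ 2) (hε₀ : 2 * εbg ≤ ν.ε₀ * ((F.P K).L : ℝ) ^ 2)
    (hsol : ∀ k, k ≤ K → ∀ V ∈ domAltOfRecord F N ν K k, UkExists F N K k εbg V) :
    ∀ k, k ≤ K → ∀ V ∈ domAltOfRecord F N ν K k, ∀ j < k,
      UkExists F N K (j + 1) εbg (Averaging.iter (avOfRecord F N K) (j + 1) (Uk F N K k εbg V)) :=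
  fun k hk V hV j hj => hsol (j + 1) (by omega) _ (iterUk_succ_mem_domAlt_of_ukExists ν hε hε3 hε2 hε₀ hV (hsol k hk V hV) hj)

/-- ★★ **`huniq` FROM THE LEVEL-WISE `h11`** — the doors' third [B11] binder is a consequence of the first: uniqueness of the minimal orbit at the averaged data `Ū^{j+1}(U_k V)`, `j < k`,
`V ∈ domAlt_k`, is `h11` at level `j+1` on `domAlt_{j+1}`, which contains those data ([B7] (53) nesting under the doors' own numerics `hε3 hε2 hε₀` at `εbg`).  ONE BINDER GONE at no new
hypothesis.  CONDITIONAL on `h11` (N07); nothing of Bałaban's asserted. [cite: Balaban1985Variational, Thm 1 (6) p.279; Balaban1985Averaging, Prop. 2 (53) p.26; Balaban1987RG1, (1.1) p.260] -/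
theorem huniq_of_h11 (ν : Stage7Numerics) {εbg : ℝ} {K : ℕ} (hε : 0 < εbg)
    (hε3 : (143 * (((((F.P K).d + 4 : ℕ) : ℝ)) ^ 2 / 4) ^ 2) * εbg ≤ 1 / 3)
    (hε2 : 2 * εbg ≤ 2 * deltaSU (Fin N) / ((((F.P K).d + 4) * (F.P K).L : ℕ) : ℝ) ^ 2) (hε₀ : 2 * εbg ≤ ν.ε₀ * ((F.P K).L : ℝ) ^ 2)
    (h11 : ∀ k, k ≤ K → ∀ V ∈ domAltOfRecord F N ν K k, UkExists F N K k εbg V ∧ UniqueUkOrbit F N K k εbg V) :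
    ∀ k, k ≤ K → ∀ V ∈ domAltOfRecord F N ν K k, ∀ j < k,
      UniqueUkOrbit F N K (j + 1) εbg (Averaging.iter (avOfRecord F N K) (j + 1) (Uk F N K k εbg V)) :=
  fun k hk V hV j hj =>
    (h11 (j + 1) (by omega) _ (iterUk_succ_mem_domAlt_of_ukExists ν hε hε3 hε2 hε₀ hV (h11 k hk V hV).1 hj)).2

/-! ## §4  Both hierarchical slots from N07's Theorem-1 slot AT OBJECTS + NODE 00's ₈a rows + `hreg8` + the two-radii numerics -/

/-- The `η`-bookkeeping of §4: `B₃·(2ε(L^{j+1}η_k)²)·η_{j+1}² = 2B₃ε·η_k²` (`L^{j+1}η_{j+1} = 1`). [cite: Balaban1987RG1, (1.1)–(1.2) p.260 (bookkeeping)] -/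
theorem eta_bookkeeping {K : ℕ} (j k : ℕ) (B₃ ε : ℝ) :
    B₃ * (2 * ε * (((F.P K).L : ℝ) ^ (j + 1) * (F.P K).eta k) ^ 2) * (F.P K).eta (j + 1) ^ 2 = 2 * B₃ * ε * (F.P K).eta k ^ 2 := by
  have hL0 : ((F.P K).L : ℝ) ≠ 0 := by exact_mod_cast (F.P K).L_pos.ne'
  have hone : ((F.P K).L : ℝ) ^ (j + 1) * (F.P K).eta (j + 1) = 1 := by
    rw [Params.eta, ← mul_pow, mul_inv_cancel₀ hL0, one_pow]
  calc B₃ * (2 * ε * (((F.P K).L : ℝ) ^ (j + 1) * (F.P K).eta k) ^ 2) * (F.P K).eta (j + 1) ^ 2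
      = 2 * B₃ * ε * (F.P K).eta k ^ 2 * (((F.P K).L : ℝ) ^ (j + 1) * (F.P K).eta (j + 1)) ^ 2 := by ring
    _ = 2 * B₃ * ε * (F.P K).eta k ^ 2 := by rw [hone, one_pow, mul_one]

/-- ★★★ **BOTH HIERARCHICAL SLOTS AT ONE DATUM FROM THEOREM 1 AT OBJECTS + ₈a's ROW (member `(K, j+1)`, radius `εbg`; dag-n21-c's p454585 currency VERBATIM) + THE LEVEL-`k`
(8)-MEMBERSHIP `hU₀ : U_k^{(εbg)}(V) ∈ bgReg_k(εreg)` (the displayed `hreg8` at `V`) + numerics `0 < εreg`, (53) at `εreg`, `2εreg ≤ a₁`, `0 ≤ B₃`, `2B₃·εreg ≤ εbg ≤ a₀`**: (a) the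
level-`(j+1)` problem is SOLVABLE at `W = Ū^{j+1}(U_k V)` at radius `εbg` (`W` is `2εreg(L^{j+1}η_k)²`-regular by (53), `plaqSmall_iter_avOfRecord_level`; then ₈a's row) and (b) its minimiser
of record is `εbg·η_k²`-regular, `U_{j+1}(W) ∈ bgReg_k(εbg)` ((8) at level `j+1`, `plaqSmall_Uk_of_thm1_objects`: `PlaqSmall(B₃·2εreg(L^{j+1}η_k)²·η_{j+1}²) = PlaqSmall(2B₃εreg·η_k²)`).
CONDITIONAL on the two displayed slots; nothing of Bałaban's asserted. [cite: Balaban1985Variational, Thm 1 (6) and (8) p.279; Balaban1985Averaging, Prop. 2 (53) p.26; Balaban1987RG1, (1.1)–(1.2) p.260] -/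
theorem hsolH_hreg8H_at_of_thm1Objects_of_ukRows (ν : Stage7Numerics) {εbg a₀ a₁ B₃ : ℝ} {K k j : ℕ} (hj : j < k)
    (hT1 : ∀ ε₁ : ℝ, 0 < ε₁ → ε₁ ≤ a₁ → ∀ W : GaugeField (F.P K) (j + 1) (SU N), PlaqSmall ε₁ W →
      (∃ U : GaugeField (F.P K) 0 (SU N), IsBackground (avOfRecord F N K) {U | InUkClassB11 F N K (j + 1) (B₃ * ε₁) U} (j + 1) W U) ∧
      (∀ ε₀ : ℝ, B₃ * ε₁ ≤ ε₀ → ε₀ ≤ a₀ → ∀ U U' : GaugeField (F.P K) 0 (SU N),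
          IsBackground (avOfRecord F N K) {U | InUkClassB11 F N K (j + 1) (B₃ * ε₁) U} (j + 1) W U →
          IsBackground (avOfRecord F N K) {U | InUkClassB11 F N K (j + 1) ε₀ U} (j + 1) W U' → InUkClassB11 F N K (j + 1) ε₀ U ∧ OrbitRel (j + 1) U U'))
    (hUk : ∀ (W : GaugeField (F.P K) (j + 1) (SU N)) (δ : ℝ), 0 < δ → δ ≤ a₁ → B₃ * δ ≤ εbg → PlaqSmall δ W →
      UkExists F N K (j + 1) εbg W ∧ InUkClassB11 F N K (j + 1) εbg (Uk F N K (j + 1) εbg W))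
    {V : GaugeField (F.P K) k (SU N)} (hU₀ : Uk F N K k εbg V ∈ bgReg F N K k ν.εreg)
    (hB₃ : 0 ≤ B₃) (hεreg : 0 < ν.εreg)
    (hr3 : (143 * (((((F.P K).d + 4 : ℕ) : ℝ)) ^ 2 / 4) ^ 2) * ν.εreg ≤ 1 / 3)
    (hr2 : 2 * ν.εreg ≤ 2 * deltaSU (Fin N) / ((((F.P K).d + 4) * (F.P K).L : ℕ) : ℝ) ^ 2)
    (hra : 2 * ν.εreg ≤ a₁) (hB : 2 * B₃ * ν.εreg ≤ εbg) (hhi : εbg ≤ a₀) :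
    UkExists F N K (j + 1) εbg (Averaging.iter (avOfRecord F N K) (j + 1) (Uk F N K k εbg V)) ∧
      Uk F N K (j + 1) εbg (Averaging.iter (avOfRecord F N K) (j + 1) (Uk F N K k εbg V)) ∈ bgReg F N K k εbg := by
  have hL0 : (0 : ℝ) < (F.P K).L := by exact_mod_cast (F.P K).L_pos
  have hW : PlaqSmall (2 * ν.εreg * (((F.P K).L : ℝ) ^ (j + 1) * (F.P K).eta k) ^ 2)
      (Averaging.iter (avOfRecord F N K) (j + 1) (Uk F N K k εbg V)) :=
    plaqSmall_iter_avOfRecord_level K k hεreg hr3 hr2 ((mem_bgReg_iff F N K k _ _).1 hU₀) (Nat.succ_le_of_lt hj)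
  have hx0 : 0 ≤ ((F.P K).L : ℝ) ^ (j + 1) * (F.P K).eta k := by unfold Params.eta; positivity
  have hxpos : 0 < ((F.P K).L : ℝ) ^ (j + 1) * (F.P K).eta k := by unfold Params.eta; positivity
  have hsq1 : (((F.P K).L : ℝ) ^ (j + 1) * (F.P K).eta k) ^ 2 ≤ 1 := pow_le_one₀ hx0 (pow_succ_mul_eta_le_one hj)
  have hδpos : 0 < 2 * ν.εreg * (((F.P K).L : ℝ) ^ (j + 1) * (F.P K).eta k) ^ 2 := by positivity
  have hδle : 2 * ν.εreg * (((F.P K).L : ℝ) ^ (j + 1) * (F.P K).eta k) ^ 2 ≤ 2 * ν.εreg := by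
    calc 2 * ν.εreg * (((F.P K).L : ℝ) ^ (j + 1) * (F.P K).eta k) ^ 2 ≤ 2 * ν.εreg * 1 := by gcongr
      _ = 2 * ν.εreg := mul_one _
  have hδa : 2 * ν.εreg * (((F.P K).L : ℝ) ^ (j + 1) * (F.P K).eta k) ^ 2 ≤ a₁ := hδle.trans hra
  have hBδ : B₃ * (2 * ν.εreg * (((F.P K).L : ℝ) ^ (j + 1) * (F.P K).eta k) ^ 2) ≤ εbg :=
    (mul_le_mul_of_nonneg_left hδle hB₃).trans (by linarith)
  refine ⟨(hUk _ _ hδpos hδa hBδ hW).1, ?_⟩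
  have h8 := plaqSmall_Uk_of_thm1_objects hT1 hUk hhi hδpos hδa hBδ hW
  rw [mem_bgReg_iff]
  intro p
  refine (h8 p).trans_le ?_
  rw [eta_bookkeeping]
  exact mul_le_mul_of_nonneg_right hB (sq_nonneg _)

/-- ★★★ **THE TWO HIERARCHICAL SLOTS `hsolH ∧ hreg8H` ON THE SMALL-FIELD DOMAINS FROM THEOREM 1 AT OBJECTS + ₈a's ROWS + `hreg8` + TWO-RADII NUMERICS** — the ∀-packaging of
`hsolH_hreg8H_at_of_thm1Objects_of_ukRows` (slots read at the member `(K, j+1)`; `hT1`∕`hUk` VERBATIM the hypotheses of g2 FILE 3 `hreg8_of_thm1Objects_of_ukRows`).  CONDITIONAL; nothing asserted.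
[cite: Balaban1985Variational, Thm 1 (6) and (8) p.279; Balaban1985Averaging, Prop. 2 (53) p.26; Balaban1987RG1, (1.1)–(1.2) p.260] -/
theorem hsolH_hreg8H_of_thm1Objects_of_ukRows_of_reg8 (ν : Stage7Numerics) (εbg a₀ a₁ B₃ : ℝ) (K : ℕ)
    (hT1 : ∀ k, k ≤ K → ∀ ε₁ : ℝ, 0 < ε₁ → ε₁ ≤ a₁ → ∀ V : GaugeField (F.P K) k (SU N), PlaqSmall ε₁ V →
      (∃ U : GaugeField (F.P K) 0 (SU N), IsBackground (avOfRecord F N K) {U | InUkClassB11 F N K k (B₃ * ε₁) U} k V U) ∧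
      (∀ ε₀ : ℝ, B₃ * ε₁ ≤ ε₀ → ε₀ ≤ a₀ → ∀ U U' : GaugeField (F.P K) 0 (SU N),
          IsBackground (avOfRecord F N K) {U | InUkClassB11 F N K k (B₃ * ε₁) U} k V U →
          IsBackground (avOfRecord F N K) {U | InUkClassB11 F N K k ε₀ U} k V U' → InUkClassB11 F N K k ε₀ U ∧ OrbitRel k U U'))
    (hUk : ∀ k, k ≤ K → ∀ (V : GaugeField (F.P K) k (SU N)) (δ : ℝ), 0 < δ → δ ≤ a₁ → B₃ * δ ≤ εbg → PlaqSmall δ V →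
      UkExists F N K k εbg V ∧ InUkClassB11 F N K k εbg (Uk F N K k εbg V))
    (hreg8 : ∀ k, k ≤ K → ∀ V ∈ domAltOfRecord F N ν K k, Uk F N K k εbg V ∈ bgReg F N K k ν.εreg)
    (hB₃ : 0 ≤ B₃) (hεreg : 0 < ν.εreg)
    (hr3 : (143 * (((((F.P K).d + 4 : ℕ) : ℝ)) ^ 2 / 4) ^ 2) * ν.εreg ≤ 1 / 3)
    (hr2 : 2 * ν.εreg ≤ 2 * deltaSU (Fin N) / ((((F.P K).d + 4) * (F.P K).L : ℕ) : ℝ) ^ 2)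
    (hra : 2 * ν.εreg ≤ a₁) (hB : 2 * B₃ * ν.εreg ≤ εbg) (hhi : εbg ≤ a₀) :
    ∀ k, k ≤ K → ∀ V ∈ domAltOfRecord F N ν K k, ∀ j < k,
      UkExists F N K (j + 1) εbg (Averaging.iter (avOfRecord F N K) (j + 1) (Uk F N K k εbg V)) ∧
        Uk F N K (j + 1) εbg (Averaging.iter (avOfRecord F N K) (j + 1) (Uk F N K k εbg V)) ∈ bgReg F N K k εbg :=
  fun k hk V hV j hj => hsolH_hreg8H_at_of_thm1Objects_of_ukRows ν hj (hT1 (j + 1) (by omega)) (hUk (j + 1) (by omega)) (hreg8 k hk V hV)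
    hB₃ hεreg hr3 hr2 hra hB hhi

/-- ★★★ **`hres` FROM THEOREM 1 AT OBJECTS + ₈a's ROWS + `hreg8` + TWO-RADII NUMERICS (+ level-wise solvability `hsol` at `εbg` on the domains).**  §2 ∘ §4: [I] (1.1)'s restriction
property `HRestrict εbg K k (domAlt_k)`, `k ≤ K`, is a CONSEQUENCE of N07's level-wise Theorem-1 slot and NODE 00's ₈a rows at radius `εbg ≤ a₀`, the displayed `hreg8` and `2B₃·εreg ≤ εbg` —
UNIQUENESS-FREE.  (`hsol` is ₈a's row G₈a-1 read at `δ := ν.ε₀` — g2 FILE 3 `ukExists_εbg_of_ukRows` — or `h11`.1; kept displayed here so that no `ν.ε₀`-letter enters.)  CONDITIONAL; nothing of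
Bałaban's asserted; N09 NOT discharged. [cite: Balaban1987RG1, (1.1)–(1.2) p.260; Balaban1985Variational, Thm 1 (6) and (8) p.279; Balaban1985Averaging, Prop. 2 (53) p.26] -/
theorem hres_of_thm1Objects_of_ukRows_of_reg8 (ν : Stage7Numerics) (εbg a₀ a₁ B₃ : ℝ) (K : ℕ)
    (hT1 : ∀ k, k ≤ K → ∀ ε₁ : ℝ, 0 < ε₁ → ε₁ ≤ a₁ → ∀ V : GaugeField (F.P K) k (SU N), PlaqSmall ε₁ V →
      (∃ U : GaugeField (F.P K) 0 (SU N), IsBackground (avOfRecord F N K) {U | InUkClassB11 F N K k (B₃ * ε₁) U} k V U) ∧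
      (∀ ε₀ : ℝ, B₃ * ε₁ ≤ ε₀ → ε₀ ≤ a₀ → ∀ U U' : GaugeField (F.P K) 0 (SU N),
          IsBackground (avOfRecord F N K) {U | InUkClassB11 F N K k (B₃ * ε₁) U} k V U →
          IsBackground (avOfRecord F N K) {U | InUkClassB11 F N K k ε₀ U} k V U' → InUkClassB11 F N K k ε₀ U ∧ OrbitRel k U U'))
    (hUk : ∀ k, k ≤ K → ∀ (V : GaugeField (F.P K) k (SU N)) (δ : ℝ), 0 < δ → δ ≤ a₁ → B₃ * δ ≤ εbg → PlaqSmall δ V →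
      UkExists F N K k εbg V ∧ InUkClassB11 F N K k εbg (Uk F N K k εbg V))
    (hsol : ∀ k, k ≤ K → ∀ V ∈ domAltOfRecord F N ν K k, UkExists F N K k εbg V)
    (hreg8 : ∀ k, k ≤ K → ∀ V ∈ domAltOfRecord F N ν K k, Uk F N K k εbg V ∈ bgReg F N K k ν.εreg)
    (hB₃ : 0 ≤ B₃) (hεreg : 0 < ν.εreg)
    (hr3 : (143 * (((((F.P K).d + 4 : ℕ) : ℝ)) ^ 2 / 4) ^ 2) * ν.εreg ≤ 1 / 3)
    (hr2 : 2 * ν.εreg ≤ 2 * deltaSU (Fin N) / ((((F.P K).d + 4) * (F.P K).L : ℕ) : ℝ) ^ 2)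
    (hra : 2 * ν.εreg ≤ a₁) (hB : 2 * B₃ * ν.εreg ≤ εbg) (hhi : εbg ≤ a₀) :
    ∀ k, k ≤ K → HRestrict F N εbg K k (domAltOfRecord F N ν K k) := by
  have hε : 0 ≤ εbg := by nlinarith
  have H := hsolH_hreg8H_of_thm1Objects_of_ukRows_of_reg8 ν εbg a₀ a₁ B₃ K hT1 hUk hreg8 hB₃ hεreg hr3 hr2 hra hB hhi
  exact hres_of_hsolH_of_hreg8H hε K (fun k => domAltOfRecord F N ν K k) hsol (fun k hk V hV j hj => (H k hk V hV j hj).1)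
    (fun k hk V hV j hj => (H k hk V hV j hj).2)

/-- ★★ **ALL THREE RADIUS∕HIERARCHY CLAUSES OF THE N09 DOORS — `hres`, `huniq`, `hreg8` — FROM {level-wise `h11`, N07's Theorem-1 slot at objects `hT1`, ₈a's rows `hUk`, numerics}.**
`hreg8` is this seat's g2 FILE 3 `hreg8_of_thm1Objects_of_ukRows` (`0 < ν.ε₀ ≤ a₁`, `B₃ν.ε₀ ≤ εreg ≤ εbg ≤ a₀`); `hres` is §4's `hres_of_thm1Objects_of_ukRows_of_reg8` on top of it (`0 < εreg`,
(53) at `εreg`, `2εreg ≤ a₁`, `0 ≤ B₃`, `2B₃εreg ≤ εbg`); `huniq` is §3's `huniq_of_h11` (`0 < εbg`, (53) at `εbg`, `2εbg ≤ ν.ε₀L²`).  After this theorem an N09 door's [B11] input is the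
LEVEL-WISE `h11` plus N07's two OBJECT slots — nothing hierarchical, nothing at the second radius.  CONDITIONAL on those slots (levels `k ≥ 1` = Bałaban's Theorem 1, proved nowhere in the
tree); nothing of Bałaban's asserted; N09 NOT discharged. [cite: Balaban1985Variational, Thm 1 (6) and (8) p.279; Balaban1987RG1, (1.1)–(1.2) p.260; Balaban1985Averaging, Prop. 2 (53) p.26] -/
theorem hres_huniq_hreg8_of_thm1Objects_of_ukRows_of_h11 (ν : Stage7Numerics) (εbg a₀ a₁ B₃ : ℝ) (K : ℕ)
    (hT1 : ∀ k, k ≤ K → ∀ ε₁ : ℝ, 0 < ε₁ → ε₁ ≤ a₁ → ∀ V : GaugeField (F.P K) k (SU N), PlaqSmall ε₁ V →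
      (∃ U : GaugeField (F.P K) 0 (SU N), IsBackground (avOfRecord F N K) {U | InUkClassB11 F N K k (B₃ * ε₁) U} k V U) ∧
      (∀ ε₀ : ℝ, B₃ * ε₁ ≤ ε₀ → ε₀ ≤ a₀ → ∀ U U' : GaugeField (F.P K) 0 (SU N),
          IsBackground (avOfRecord F N K) {U | InUkClassB11 F N K k (B₃ * ε₁) U} k V U →
          IsBackground (avOfRecord F N K) {U | InUkClassB11 F N K k ε₀ U} k V U' → InUkClassB11 F N K k ε₀ U ∧ OrbitRel k U U'))
    (hUk : ∀ k, k ≤ K → ∀ (V : GaugeField (F.P K) k (SU N)) (δ : ℝ), 0 < δ → δ ≤ a₁ → B₃ * δ ≤ εbg → PlaqSmall δ V →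
      UkExists F N K k εbg V ∧ InUkClassB11 F N K k εbg (Uk F N K k εbg V))
    (h11 : ∀ k, k ≤ K → ∀ V ∈ domAltOfRecord F N ν K k, UkExists F N K k εbg V ∧ UniqueUkOrbit F N K k εbg V)
    (hB₃ : 0 ≤ B₃) (hε₀ : 0 < ν.ε₀) (hε₀a : ν.ε₀ ≤ a₁) (hB₀ : B₃ * ν.ε₀ ≤ ν.εreg) (hεreg : 0 < ν.εreg)
    (hr3 : (143 * (((((F.P K).d + 4 : ℕ) : ℝ)) ^ 2 / 4) ^ 2) * ν.εreg ≤ 1 / 3)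
    (hr2 : 2 * ν.εreg ≤ 2 * deltaSU (Fin N) / ((((F.P K).d + 4) * (F.P K).L : ℕ) : ℝ) ^ 2)
    (hra : 2 * ν.εreg ≤ a₁) (hB : 2 * B₃ * ν.εreg ≤ εbg) (hle : ν.εreg ≤ εbg) (hhi : εbg ≤ a₀) (hε : 0 < εbg)
    (hε3 : (143 * (((((F.P K).d + 4 : ℕ) : ℝ)) ^ 2 / 4) ^ 2) * εbg ≤ 1 / 3)
    (hε2 : 2 * εbg ≤ 2 * deltaSU (Fin N) / ((((F.P K).d + 4) * (F.P K).L : ℕ) : ℝ) ^ 2) (hε₀L : 2 * εbg ≤ ν.ε₀ * ((F.P K).L : ℝ) ^ 2) :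
    (∀ k, k ≤ K → HRestrict F N εbg K k (domAltOfRecord F N ν K k)) ∧
      (∀ k, k ≤ K → ∀ V ∈ domAltOfRecord F N ν K k, ∀ j < k,
        UniqueUkOrbit F N K (j + 1) εbg (Averaging.iter (avOfRecord F N K) (j + 1) (Uk F N K k εbg V))) ∧
      (∀ k, k ≤ K → ∀ V ∈ domAltOfRecord F N ν K k, Uk F N K k εbg V ∈ bgReg F N K k ν.εreg) := by
  have hreg8 := hreg8_of_thm1Objects_of_ukRows ν εbg a₀ a₁ B₃ K hT1 hUk hε₀ hε₀a hB₀ hle hhi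
  exact ⟨hres_of_thm1Objects_of_ukRows_of_reg8 ν εbg a₀ a₁ B₃ K hT1 hUk (fun k hk V hV => (h11 k hk V hV).1) hreg8 hB₃ hεreg hr3 hr2 hra hB hhi,
    huniq_of_h11 ν hε hε3 hε2 hε₀L h11, hreg8⟩

/-! ## §5  A6: the numerics letters are jointly satisfiable inside print's window; the object slots are theorems at the zero member -/

/-- **THE TWO-RADII NUMERICS OF §4 ARE JOINTLY SATISFIABLE INSIDE PRINT's WINDOW**: for any `0 < a₀`, `0 < a₁`, `0 ≤ B₃` there are radii `0 < εreg ≤ εbg = a₀` with (53)'s side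
conditions at `εreg`, `2εreg ≤ a₁` and `2B₃εreg ≤ εbg ≤ a₀` (dag-n21-c's `smallness_inhabited` supplies the (53) pair).  So §4's numerics are not an empty range, and they hold together with g2's
one-token re-key `εbg := a₀`. [cite: Balaban1985Variational, Thm 1 p.279 (bookkeeping); Balaban1985Averaging, Prop. 2 (52)–(53) p.26] -/
theorem twoRadii_numerics_inhabited (K : ℕ) {a₀ a₁ B₃ : ℝ} (ha₀ : 0 < a₀) (ha₁ : 0 < a₁) (hB₃ : 0 ≤ B₃) :
    ∃ εreg εbg : ℝ, 0 < εreg ∧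
      (143 * (((((F.P K).d + 4 : ℕ) : ℝ)) ^ 2 / 4) ^ 2) * εreg ≤ 1 / 3 ∧
      2 * εreg ≤ 2 * deltaSU (Fin N) / ((((F.P K).d + 4) * (F.P K).L : ℕ) : ℝ) ^ 2 ∧
      2 * εreg ≤ a₁ ∧ 2 * B₃ * εreg ≤ εbg ∧ εbg ≤ a₀ ∧ εreg ≤ εbg := by
  obtain ⟨α₀, hα, hα3, hα2, -⟩ := smallness_inhabited (F := F) (N := N) K 0
  refine ⟨min α₀ (min (a₁ / 2) (a₀ / (2 * B₃ + 2))), a₀, lt_min hα (lt_min (by positivity) (by positivity)), ?_, ?_, ?_, ?_, le_rfl, ?_⟩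
  · exact (mul_le_mul_of_nonneg_left (min_le_left _ _) (by positivity)).trans hα3
  · linarith [min_le_left α₀ (min (a₁ / 2) (a₀ / (2 * B₃ + 2)))]
  · linarith [min_le_right α₀ (min (a₁ / 2) (a₀ / (2 * B₃ + 2))), min_le_left (a₁ / 2) (a₀ / (2 * B₃ + 2))]
  · have hm : min α₀ (min (a₁ / 2) (a₀ / (2 * B₃ + 2))) ≤ a₀ / (2 * B₃ + 2) :=
      (min_le_right _ _).trans (min_le_right _ _)
    have h2 : 2 * B₃ * (a₀ / (2 * B₃ + 2)) ≤ a₀ := by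
      rw [mul_div_assoc']
      rw [div_le_iff₀ (by positivity)]
      nlinarith
    exact (mul_le_mul_of_nonneg_left hm (by positivity)).trans h2
  · have hm : min α₀ (min (a₁ / 2) (a₀ / (2 * B₃ + 2))) ≤ a₀ / (2 * B₃ + 2) :=
      (min_le_right _ _).trans (min_le_right _ _)
    have h2 : a₀ / (2 * B₃ + 2) ≤ a₀ := by
      rw [div_le_iff₀ (by positivity)]
      nlinarith
    exact hm.trans h2

/-- **A6 GUARD — §4's OBJECT SLOTS ARE THEOREMS AT THE ZERO-STEP MEMBER** (`K = 0`, `B₃ = 7`: dag-n21-c's `thm1_objects_levelZero'` ∕ `ukRows_levelZero`), so the hypothesis set of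
`hsolH_hreg8H_of_thm1Objects_of_ukRows_of_reg8` is inhabited for every numerics with `0 < ν.εreg`, (53) at `εreg`, `2εreg ≤ a₁`, `14·εreg ≤ εbg ≤ a₀` and every `hreg8`; the conclusion at
`K = 0` quantifies over `j < k ≤ 0` and is therefore empty — nothing about the levels `k ≥ 1` (Bałaban's Theorem 1, proved nowhere in the tree; this seat's g3 flat sector
`…N09FlatSectorUniqueness.thm1Clauses_flatSector` inhabits the CONCLUSIONS `hres`∕`huniq` at every level instead). [cite: Balaban1987RG1, (0.17) p.255 (bookkeeping)] -/
theorem hierarchyBinders_levelZero (ν : Stage7Numerics) (εbg a₀ a₁ : ℝ)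
    (hreg8 : ∀ k, k ≤ 0 → ∀ V ∈ domAltOfRecord F N ν 0 k, Uk F N 0 k εbg V ∈ bgReg F N 0 k ν.εreg) (hεreg : 0 < ν.εreg)
    (hr3 : (143 * (((((F.P 0).d + 4 : ℕ) : ℝ)) ^ 2 / 4) ^ 2) * ν.εreg ≤ 1 / 3)
    (hr2 : 2 * ν.εreg ≤ 2 * deltaSU (Fin N) / ((((F.P 0).d + 4) * (F.P 0).L : ℕ) : ℝ) ^ 2)
    (hra : 2 * ν.εreg ≤ a₁) (hB : 2 * 7 * ν.εreg ≤ εbg) (hhi : εbg ≤ a₀) :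
    ∀ k, k ≤ 0 → ∀ V ∈ domAltOfRecord F N ν 0 k, ∀ j < k,
      UkExists F N 0 (j + 1) εbg (Averaging.iter (avOfRecord F N 0) (j + 1) (Uk F N 0 k εbg V)) ∧
        Uk F N 0 (j + 1) εbg (Averaging.iter (avOfRecord F N 0) (j + 1) (Uk F N 0 k εbg V)) ∈ bgReg F N 0 k εbg := by
  refine hsolH_hreg8H_of_thm1Objects_of_ukRows_of_reg8 ν εbg a₀ a₁ 7 0 (fun k hk => ?_) (fun k hk => ?_) hreg8 (by norm_num) hεreg hr3 hr2 hra hB hhi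
  · obtain rfl : k = 0 := Nat.le_zero.1 hk
    exact thm1_objects_levelZero' 0 a₀ a₁
  · obtain rfl : k = 0 := Nat.le_zero.1 hk
    exact ukRows_levelZero 0 a₁ εbg

end Summit.QuantumFields.YangMills.BalabanUVNodes.N09HierarchyBindersOfLevelwiseThm1

end
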